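import Mathlib
import Summits.Ventures.HodgeRepro.Tier4.Line1.RtfGeometric

/-!
# Tier4/Line1/ConvTest — LINE L1, J2.c′ rung (c′.3) (a)–(b): convolution of test functions, the approximate identity

Blind re-derivation cell `pub-hodge-repro`, Tier 4 «prove the step» (README §9–§10), seat t4-L1-p2 (prover, gen 0),
LINE L1 (t4-plan-1), assignment S12232 (J2.c′), rungs S12304.  This module, on the group alone (no orbits):
`IsTest.exists_nhds_norm_sub_lt` — UNIFORM CONTINUITY of a test function under right translation, by the tube lemma
(`IsCompact.eventually_forall_of_forall_eventually`; no uniform-space instance, no local compactness);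
`support_conv_subset` and `conv_isTest` — the convolution `f₁ ⋆ f₂` of two test functions is a test function with
`tsupport (f₁ ⋆ f₂) ⊆ tsupport f₁ · tsupport f₂` (continuity: the parametric integral over the compact `tsupport f₁`,
`RtfGeometric`'s tube-lemma continuity; `T2Space G` makes the compact product closed); `exists_normalised_bump` — a
test function `f₂ ≥ 0` supported in a given open `N ∋ 1` with `∫ f₂(h⁻¹ g) dμ(h) = 1` for EVERY `g` (LEFT invariance of
Haar measure only; `rightInv` is not used); `norm_conv_sub_le` — the APPROXIMATE-IDENTITY estimate
`‖(f₁ ⋆ f₂)(g) − f₁(g)‖ ≤ η` for such `f₂` supported in `V⁻¹` when `‖f₁(g u) − f₁(g)‖ ≤ η` for `u ∈ V`.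
Imports Mathlib + `RtfGeometric` (p663290) only.

Nothing here says anything about the status of the Hodge conjecture for CM abelian varieties, which is NOT proved
(HC_CM is NOT proved by anyone in this repository).
-/

set_option autoImplicit false

noncomputable section

/-! ## ConvTest — the convolution of test functions is a test function; uniform continuity of a test function
under right translation (tube lemma); the normalised bump and the approximate-identity estimate
(t4-L1-p2, for J2.c′ (c′.3)) -/

namespace Summit.Ventures.HodgeRepro.Tier4.Line1.RTF

open MeasureTheory Topology Filter Set
open scoped Pointwise

variable {G : Type} [Group G] [TopologicalSpace G] [IsTopologicalGroup G] [MeasurableSpace G]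
  [BorelSpace G]

omit [MeasurableSpace G] [BorelSpace G] in
/-- UNIFORM CONTINUITY under right translation, by the tube lemma (no uniform-space instance): for a test
function `f` and `η > 0` there is a neighbourhood `V` of `1` with `‖f (g u) − f g‖ < η` for ALL `g` and `u ∈ V`.
On the compact support `K` the tube lemma (`IsCompact.eventually_forall_of_forall_eventually`) controls `g ∈ K`;
the same lemma with `u⁻¹` controls the `g` with `g u ∈ K`; elsewhere both values vanish. -/
theorem IsTest.exists_nhds_norm_sub_lt {f : G → ℂ} (hf : IsTest f) {η : ℝ} (hη : 0 < η) :
    ∃ V ∈ 𝓝 (1 : G), ∀ g : G, ∀ u ∈ V, ‖f (g * u) - f g‖ < η := by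
  have hK : IsCompact (tsupport f) := hf.compact
  have h₁ : ∀ᶠ u in 𝓝 (1 : G), ∀ g ∈ tsupport f, ‖f (g * u) - f g‖ < η := by
    apply hK.eventually_forall_of_forall_eventually
    intro g _
    have hc : Continuous fun z : G × G => ‖f (z.2 * z.1) - f z.2‖ :=
      ((hf.cont.comp (continuous_snd.mul continuous_fst)).sub (hf.cont.comp continuous_snd)).norm
    have h0 : Tendsto (fun z : G × G => ‖f (z.2 * z.1) - f z.2‖) (𝓝 (1, g)) (𝓝 0) := by
      simpa using hc.tendsto (1, g)
    exact h0.eventually (gt_mem_nhds hη)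
  have h₂ : ∀ᶠ u in 𝓝 (1 : G), ∀ g ∈ tsupport f, ‖f (g * u⁻¹) - f g‖ < η := by
    apply hK.eventually_forall_of_forall_eventually
    intro g _
    have hc : Continuous fun z : G × G => ‖f (z.2 * z.1⁻¹) - f z.2‖ :=
      ((hf.cont.comp (continuous_snd.mul continuous_fst.inv)).sub (hf.cont.comp continuous_snd)).norm
    have h0 : Tendsto (fun z : G × G => ‖f (z.2 * z.1⁻¹) - f z.2‖) (𝓝 (1, g)) (𝓝 0) := by
      simpa using hc.tendsto (1, g)
    exact h0.eventually (gt_mem_nhds hη)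
  refine ⟨_, h₁.and h₂, ?_⟩
  rintro g u ⟨hu₁, hu₂⟩
  by_cases hg : g ∈ tsupport f
  · exact hu₁ g hg
  · by_cases hgu : g * u ∈ tsupport f
    · have := hu₂ (g * u) hgu
      rw [mul_inv_cancel_right, norm_sub_rev] at this
      exact this
    · rw [image_eq_zero_of_notMem_tsupport hg, image_eq_zero_of_notMem_tsupport hgu, sub_zero, norm_zero]
      exact hη

namespace Setting

variable (S : Setting G)

omit [IsTopologicalGroup G] [BorelSpace G] in
/-- the support of a convolution lies in the product of the supports -/
theorem support_conv_subset (f₁ f₂ : G → ℂ) :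
    Function.support (S.conv f₁ f₂) ⊆ tsupport f₁ * tsupport f₂ := by
  intro g hg
  rw [Function.mem_support] at hg
  by_contra hcon
  apply hg
  unfold Setting.conv
  apply integral_eq_zero_of_ae
  apply Filter.Eventually.of_forall
  intro h
  by_cases h₁ : f₁ h = 0
  · simp [h₁]
  by_cases h₂ : f₂ (h⁻¹ * g) = 0
  · simp [h₂]
  exfalso
  apply hcon
  have hg' : g = h * (h⁻¹ * g) := by group
  rw [hg']
  exact Set.mul_mem_mul (subset_tsupport _ h₁) (subset_tsupport _ h₂)

/-- CONVOLUTION OF TEST FUNCTIONS is a test function, with `tsupport (f₁ ⋆ f₂) ⊆ tsupport f₁ · tsupport f₂`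
(continuity: the parametric integral over the compact `tsupport f₁` of a jointly continuous integrand, by the tube
lemma; the product of the compact supports is compact, hence closed in the Hausdorff `G`). -/
theorem conv_isTest [T2Space G] {f₁ f₂ : G → ℂ} (h₁ : IsTest f₁) (h₂ : IsTest f₂) :
    IsTest (S.conv f₁ f₂) ∧ tsupport (S.conv f₁ f₂) ⊆ tsupport f₁ * tsupport f₂ := by
  haveI : IsFiniteMeasureOnCompacts S.μ := S.haar.toIsFiniteMeasureOnCompacts
  have hprod : IsCompact (tsupport f₁ * tsupport f₂) := h₁.compact.mul h₂.compact
  have hsub : tsupport (S.conv f₁ f₂) ⊆ tsupport f₁ * tsupport f₂ :=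
    closure_minimal (S.support_conv_subset f₁ f₂) hprod.isClosed
  refine ⟨⟨?_, hprod.of_isClosed_subset (isClosed_tsupport _) hsub⟩, hsub⟩
  have hcont : Continuous fun g : G => ∫ h in tsupport f₁, f₁ h * f₂ (h⁻¹ * g) ∂S.μ := by
    apply Geometric.continuous_setIntegral_of_continuous_uncurry
    · rw [(isClosed_tsupport f₁).closure_eq]
      exact h₁.compact
    · exact (h₁.cont.comp continuous_snd).mul
        (h₂.cont.comp (continuous_snd.inv.mul continuous_fst))
  have heq : (fun g : G => ∫ h in tsupport f₁, f₁ h * f₂ (h⁻¹ * g) ∂S.μ) = S.conv f₁ f₂ := by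
    funext g
    unfold Setting.conv
    apply setIntegral_eq_integral_of_forall_compl_eq_zero
    intro h hh
    rw [image_eq_zero_of_notMem_tsupport hh, zero_mul]
  rw [heq] at hcont
  exact hcont

/-- THE NORMALISED BUMP at `1`: for an open `N ∋ 1` (in a locally compact Hausdorff group) there is a test function
`f₂` with real values `≥ 0`, `tsupport f₂ ⊆ N`, and `∫ f₂(h⁻¹ g) dμ(h) = 1` for EVERY `g` (left invariance). -/
theorem exists_normalised_bump [LocallyCompactSpace G] [T2Space G] {N : Set G} (hN : IsOpen N)
    (h1 : (1 : G) ∈ N) :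
    ∃ f₂ : G → ℂ, IsTest f₂ ∧ tsupport f₂ ⊆ N ∧ (∀ g, ∃ r : ℝ, 0 ≤ r ∧ f₂ g = r) ∧
      ∀ g : G, ∫ h, f₂ (h⁻¹ * g) ∂S.μ = 1 := by
  haveI : IsFiniteMeasureOnCompacts S.μ := S.haar.toIsFiniteMeasureOnCompacts
  haveI : S.μ.IsOpenPosMeasure := S.haar.toIsOpenPosMeasure
  haveI : S.μ.IsMulLeftInvariant := S.haar.toIsMulLeftInvariant
  -- an open `N'` with `closure N' ⊆ N`
  obtain ⟨N', hN'o, h1N', hN'N, -⟩ :=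
    exists_open_between_and_isCompact_closure isCompact_singleton hN (singleton_subset_iff.2 h1)
  obtain ⟨b, hb1, hb0, hbc, hb01⟩ := exists_continuous_one_zero_of_isCompact isCompact_singleton
    hN'o.isClosed_compl (disjoint_compl_right_iff_subset.2 h1N')
  have hbN : tsupport b ⊆ N := by
    refine (closure_minimal ?_ isClosed_closure).trans hN'N
    intro x hx
    by_contra hxN
    exact hx (hb0 (fun hxN' => hxN (subset_closure hxN')))
  have hbnn : ∀ x, 0 ≤ b x := fun x => (hb01 x).1
  -- the mass `c = ∫ b (h⁻¹)`
  set c : ℝ := ∫ h, b h⁻¹ ∂S.μ with hc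
  have hbinv : Continuous fun h : G => b h⁻¹ := b.continuous.comp continuous_inv
  have hbinvc : HasCompactSupport fun h : G => b h⁻¹ := hbc.comp_homeomorph (Homeomorph.inv G)
  have hcpos : 0 < c := by
    rw [hc, integral_pos_iff_support_of_nonneg (fun h => hbnn _)
      (hbinv.integrable_of_hasCompactSupport hbinvc)]
    apply (hbinv.isOpen_support).measure_pos S.μ
    refine ⟨1, ?_⟩
    rw [Function.mem_support, inv_one, hb1 (mem_singleton _)]
    exact one_ne_zero
  refine ⟨fun g => ((b g / c : ℝ) : ℂ), ⟨?_, ?_⟩, ?_, ?_, ?_⟩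
  · exact Complex.continuous_ofReal.comp (b.continuous.div_const c)
  · apply HasCompactSupport.comp_left (g := fun r : ℝ => ((r / c : ℝ) : ℂ)) hbc
    simp
  · refine (closure_minimal ?_ isClosed_closure).trans hbN
    intro x hx
    rw [Function.mem_support] at hx
    by_contra hxs
    apply hx
    rw [image_eq_zero_of_notMem_tsupport hxs]
    simp
  · intro g
    exact ⟨b g / c, div_nonneg (hbnn g) hcpos.le, rfl⟩
  · intro g
    have hshift : ∫ h, ((b (h⁻¹ * g) / c : ℝ) : ℂ) ∂S.μ = ∫ h, ((b h⁻¹ / c : ℝ) : ℂ) ∂S.μ := by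
      have := integral_mul_left_eq_self (μ := S.μ) (fun h : G => ((b h⁻¹ / c : ℝ) : ℂ)) g⁻¹
      simp only [mul_inv_rev, inv_inv] at this
      exact this
    have hcomm := Complex.ofRealCLM.integral_comp_comm (μ := S.μ) (φ := fun h : G => b h⁻¹ / c)
      ((hbinv.div_const c).integrable_of_hasCompactSupport
        (hbinvc.comp_left (g := fun r : ℝ => r / c) (by simp)))
    simp only [Complex.ofRealCLM_apply] at hcomm
    rw [hshift, hcomm, integral_div, ← hc, div_self hcpos.ne', Complex.ofReal_one]

omit [Group G] [TopologicalSpace G] [IsTopologicalGroup G] [MeasurableSpace G] [BorelSpace G] in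
/-- a function with non-negative real values has `‖f g‖ = (f g).re` -/
theorem norm_eq_re_of_nonneg {f : G → ℂ} (hf : ∀ g, ∃ r : ℝ, 0 ≤ r ∧ f g = r) (g : G) :
    ‖f g‖ = (f g).re := by
  obtain ⟨r, hr, hg⟩ := hf g
  rw [hg, Complex.norm_real, Real.norm_eq_abs, abs_of_nonneg hr, Complex.ofReal_re]

/-- THE APPROXIMATE-IDENTITY ESTIMATE: if `f₂ ≥ 0` is a normalised bump with `tsupport f₂ ⊆ V⁻¹` and
`‖f₁ (g u) − f₁ g‖ ≤ η` for all `g` and `u ∈ V`, then `‖(f₁ ⋆ f₂) g − f₁ g‖ ≤ η` for every `g`. -/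
theorem norm_conv_sub_le {f₁ f₂ : G → ℂ} (h₁ : IsTest f₁) (h₂ : IsTest f₂)
    (hnn : ∀ g, ∃ r : ℝ, 0 ≤ r ∧ f₂ g = r) (hnorm : ∀ g : G, ∫ h, f₂ (h⁻¹ * g) ∂S.μ = 1)
    {V : Set G} (hV : tsupport f₂ ⊆ V⁻¹) {η : ℝ}
    (hη : ∀ g : G, ∀ u ∈ V, ‖f₁ (g * u) - f₁ g‖ ≤ η) (g : G) :
    ‖S.conv f₁ f₂ g - f₁ g‖ ≤ η := by
  haveI : IsFiniteMeasureOnCompacts S.μ := S.haar.toIsFiniteMeasureOnCompacts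
  -- integrability of the two pieces
  have hf₂g : Continuous fun h : G => f₂ (h⁻¹ * g) :=
    h₂.cont.comp (continuous_inv.mul continuous_const)
  have hf₂gc : HasCompactSupport fun h : G => f₂ (h⁻¹ * g) := by
    have : (fun h : G => f₂ (h⁻¹ * g)) = f₂ ∘ (Homeomorph.mulRight g).toEquiv ∘ (Homeomorph.inv G) := by
      funext h; rfl
    rw [this]
    exact (h₂.compact.comp_homeomorph (Homeomorph.mulRight g)).comp_homeomorph (Homeomorph.inv G)
  have hi₁ : Integrable (fun h : G => f₁ h * f₂ (h⁻¹ * g)) S.μ :=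
    (h₁.cont.mul hf₂g).integrable_of_hasCompactSupport (h₁.compact.mul_right)
  have hi₂ : Integrable (fun h : G => f₁ g * f₂ (h⁻¹ * g)) S.μ :=
    (continuous_const.mul hf₂g).integrable_of_hasCompactSupport (hf₂gc.mul_left)
  have hi₃ : Integrable (fun h : G => η * ‖f₂ (h⁻¹ * g)‖) S.μ :=
    (continuous_const.mul hf₂g.norm).integrable_of_hasCompactSupport (hf₂gc.norm.mul_left)
  have hrw : S.conv f₁ f₂ g - f₁ g = ∫ h, (f₁ h - f₁ g) * f₂ (h⁻¹ * g) ∂S.μ := by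
    have hfg : f₁ g = ∫ h, f₁ g * f₂ (h⁻¹ * g) ∂S.μ := by
      rw [integral_const_mul, hnorm g, mul_one]
    conv_lhs => rw [hfg]
    unfold Setting.conv
    rw [← integral_sub hi₁ hi₂]
    congr 1
    funext h
    ring
  rw [hrw]
  calc ‖∫ h, (f₁ h - f₁ g) * f₂ (h⁻¹ * g) ∂S.μ‖
      ≤ ∫ h, η * ‖f₂ (h⁻¹ * g)‖ ∂S.μ := by
        apply norm_integral_le_of_norm_le hi₃
        apply Filter.Eventually.of_forall
        intro h
        rw [norm_mul]
        by_cases hz : f₂ (h⁻¹ * g) = 0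
        · rw [hz, norm_zero, mul_zero, mul_zero]
        · apply mul_le_mul_of_nonneg_right _ (norm_nonneg _)
          have hmem : h⁻¹ * g ∈ V⁻¹ := hV (subset_tsupport _ hz)
          rw [Set.mem_inv] at hmem
          have := hη g _ hmem
          have hh : g * (h⁻¹ * g)⁻¹ = h := by group
          rw [hh] at this
          exact this
    _ = η * ∫ h, ‖f₂ (h⁻¹ * g)‖ ∂S.μ := integral_const_mul _ _
    _ = η := by
        have hre : ∀ h : G, ‖f₂ (h⁻¹ * g)‖ = (f₂ (h⁻¹ * g)).re := fun h =>
          norm_eq_re_of_nonneg hnn _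
        simp_rw [hre]
        have hcomm := Complex.reCLM.integral_comp_comm (μ := S.μ)
          (hf₂g.integrable_of_hasCompactSupport (μ := S.μ) hf₂gc)
        simp only [Complex.reCLM_apply] at hcomm
        rw [hcomm, hnorm g, Complex.one_re, mul_one]

end Setting

end Summit.Ventures.HodgeRepro.Tier4.Line1.RTF

end
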